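import Summits.QuantumFields.YangMills.Theorems.BalabanUVNodesN15CovariantLandauTwoGridLandauFlat
import HarnessLib

/-!
# Route «BalabanUVNodes», node N15 = NE2, road (c) — PROGRAMME (P-S), XXXVIII: THE TWO-GRID LETTER OF THE TRANSPOSED COVARIANT BLOCK AVERAGE `νQ′_{T′}ᵀ − P̂_SQ′_Tᵀ` AS A STAIRCASE-FIT ROW
# (the input `φ_t` of n15-c∕238∕240–243: pointwise formula + block-diagonal majorant `n^{−(d+1)}·φ` from the column fit `φ` of the two grids' staircase transports) (dag-n15-c g24, n15-c∕245)

Cell `pub-ymgap`, seat `pub-ymgap-dag-n15-c` (generation g24; R134 (a), s1; HUMAN RULING D-0062; chair R424 venue).  `bears_on: R4∕N15 · K3⁸ SpineGivenEndpointR13SepCoPHV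
(stmt-QuantumFields-27366)`; filed `--supports stmt-QuantumFields-27366 --as helper` — COUNT-NEUTRAL.  Theorems only; 0 `sorry`.  Imports BY NAME n15-c∕197 (`csavg`), 235 (`hasMaj_of_mmul_pull`), 184a
(`blockOf_kingPr`), the T⁴ cell (`idef`, `pull`).  Nothing in the tree is modified.

* `csavg_transpose_mulVec` (`(Q′_Tᵀu)(x, i) = n^{−(d+1)}Σ_j U(B(x), a(x))_{ji}u(B(x), j)`), ★ `idef_nu_csavg_transpose_apply` (`(νQ′_{T′}ᵀ − P̂_SQ′_Tᵀ)u (x′, i) = n^{−(d+1)}Σ_j (U′ − U∘pr)_{ji}u(B′(x′), j)`: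
  the scaled transport `ν = L^{m(d+1)}` cancels `n′^{−(d+1)}` to `n^{−(d+1)}` EXACTLY), ★★ **`hasMaj_idef_nu_csavg_transpose`** (`≤ 𝟙[y = y′]·n^{−(d+1)}·φ` for the column fit `φ` of
  `U′(B′x′, a′(x′)) − U(B(pr x′), a(pr x′))` — the holonomy two-grid fit of n15-c∕185b∕185c∕187b in the scalar staircase form).

HONEST FRAMING ∕ LIMITS.  Exact identity + sup-block bookkeeping; the fit `φ` is a HYPOTHESIS (from (3.35) by the holonomy-fit lemmas — the successor's letters file); MODEL carriers; NOT
[Balaban1985BackgroundPropagators] as printed; NE2⁺ NOT PRINTED; N15 of record untouched (DISCHARGED AS CONSUMED, p687738); counts UNMOVED (typed 28∕28 · discharged 8∕27).  Restate-immune.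
-/

noncomputable section

open scoped BigOperators Matrix
open Finset

namespace Summit.QuantumFields.YangMills.BalabanUVNodes.N15.CovLandau

open Literature.MathematicalPhysics.QuantumFieldTheory.Balaban1983to89
open Literature.MathematicalPhysics.QuantumFieldTheory.Balaban1983to89.B5Prop11Plancherel (Tor fine unitVec)
open Literature.MathematicalPhysics.QuantumFieldTheory.Balaban1983to89.B11SectG (BlockNorm HasMaj)
open Literature.MathematicalPhysics.QuantumFieldTheory.Balaban1983to89.B6UnitTorusCarrier (unitTorusGeo)
open Literature.MathematicalPhysics.QuantumFieldTheory.Balaban1983to89.T4EtaRateDefect (idef idef_apply)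
open Literature.MathematicalPhysics.QuantumFieldTheory.Balaban1983to89.T4EtaRateCoeffDefect (pull pull_apply diagK)
open Literature.MathematicalPhysics.QuantumFieldTheory.King1986.Torus (blockOf tdistT)
open Summit.QuantumFields.YangMills.BalabanUVNodes.N15.MatrixSpecies (liftBlk liftMap)
open Summit.QuantumFields.YangMills.BalabanUVNodes.N15.VectorPiece (kingPr kingPrV blockCoords)
open Summit.QuantumFields.YangMills.BalabanUVNodes.N15.CovAvg (cvaStair blockOf_kingPr)
open Summit.QuantumFields.YangMills.BalabanUVNodes.N15.BackgroundModel (kappa_ofBlocks)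

variable {d : ℕ}

section Stair

variable (M : Fin (d + 1) → ℕ) [∀ μ, NeZero (M μ)] {ι : Type} [Fintype ι] [DecidableEq ι] (L k m : ℕ) [NeZero L]

/-- `(Q′_Tᵀu)(x, i) = n^{−(d+1)}·Σ_j U(B(x), a(x))_{ji}·u(B(x), j)`. [cite: Balaban1985BackgroundPropagators, (3.19) p.393 (the covariant block average, shape)] -/
theorem csavg_transpose_mulVec (nn : ℕ) [NeZero nn] (T : Fin (d + 1) → Tor (fine nn M) → Matrix ι ι ℝ) (u : Tor M × ι → ℝ) (x : Tor (fine nn M)) (i : ι) :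
    ((csavg M nn T)ᵀ *ᵥ u) (x, i) = (((nn : ℝ)) ^ (d + 1))⁻¹ * ∑ j, cvaStair M nn (fun μ b => T μ b.1) (blockOf nn M x) (blockCoords nn M x).2 0 j i * u (blockOf nn M x, j) := by
  simp only [Matrix.mulVec, dotProduct, Matrix.transpose_apply, csavg]
  rw [Fintype.sum_prod_type, Finset.sum_eq_single (blockOf nn M x)]
  · rw [Finset.mul_sum]
    refine Finset.sum_congr rfl fun j _ => ?_
    rw [if_pos rfl]
    ring
  · intro y _ hy
    refine Finset.sum_eq_zero fun j _ => ?_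
    rw [if_neg (Ne.symm hy), zero_mul]
  · exact fun h => absurd (Finset.mem_univ _) h

/-- ★ **THE TWO-GRID LETTER OF `Q′ᵀ`, POINTWISE**: `(νQ′_{T′}ᵀ − P̂_SQ′_Tᵀ)u(x′, i) = n^{−(d+1)}·Σ_j (U′(B′x′, a′x′) − U(B(pr x′), a(pr x′)))_{ji}·u(B′(x′), j)` (`ν·n′^{−(d+1)} = n^{−(d+1)}`, `B(pr x′) = B′(x′)`).
[cite: King1986, p.664 (pairing convention «x′ ∈ B^n(x)»); Balaban1985BackgroundPropagators, (3.19) p.393] -/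
theorem idef_nu_csavg_transpose_apply (T : Fin (d + 1) → Tor (fine (L ^ k) M) → Matrix ι ι ℝ) (T' : Fin (d + 1) → Tor (fine (L ^ m * L ^ k) M) → Matrix ι ι ℝ) (u : Tor M × ι → ℝ) (x' : Tor (fine (L ^ m * L ^ k) M)) (i : ι) :
    idef (((((L ^ m) ^ (d + 1) : ℕ) : ℝ)) • (LinearMap.id : (Tor M × ι → ℝ) →ₗ[ℝ] (Tor M × ι → ℝ))) (pull (liftMap (kingPr L k m M) ι)) (Matrix.mulVecLin (csavg M (L ^ m * L ^ k) T')ᵀ) (Matrix.mulVecLin (csavg M (L ^ k) T)ᵀ) u (x', i) =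
      (((((L ^ k : ℕ) : ℝ)) ^ (d + 1)))⁻¹ * ∑ j, ((cvaStair M (L ^ m * L ^ k) (fun μ b => T' μ b.1) (blockOf (L ^ m * L ^ k) M x') (blockCoords (L ^ m * L ^ k) M x').2 0) - (cvaStair M (L ^ k) (fun μ b => T μ b.1) (blockOf (L ^ k) M (kingPr L k m M x')) (blockCoords (L ^ k) M (kingPr L k m M x')).2 0)) j i * u (blockOf (L ^ m * L ^ k) M x', j) := by
  have hL : (L : ℝ) ≠ 0 := Nat.cast_ne_zero.mpr (NeZero.ne L)
  have hc : ((((L ^ m) ^ (d + 1) : ℕ) : ℝ)) * (((((L ^ m * L ^ k : ℕ) : ℝ))) ^ (d + 1))⁻¹ = (((((L ^ k : ℕ) : ℝ))) ^ (d + 1))⁻¹ := by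
    push_cast
    field_simp
    ring
  simp only [idef_apply, Pi.sub_apply, LinearMap.smul_apply, LinearMap.id_coe, id_eq, map_smul, Matrix.mulVecLin_apply, pull_apply, liftMap, Pi.smul_apply, smul_eq_mul,
    csavg_transpose_mulVec]
  rw [blockOf_kingPr, ← mul_assoc, hc, ← mul_sub, ← Finset.sum_sub_distrib]
  refine congrArg _ (Finset.sum_congr rfl fun j _ => ?_)
  rw [Matrix.sub_apply, sub_mul]

/-- ★★ **THE TWO-GRID LETTER OF `Q′ᵀ` AS A BLOCK-DIAGONAL ROW**: from the COLUMN fit `Σ_j|(U′(B′x′, a′x′) − U(B(pr x′), a(pr x′)))_{ji}| ≤ φ` of the two grids' staircase transports,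
`νQ′_{T′}ᵀ − P̂_SQ′_Tᵀ ≤ 𝟙[y = y′]·n^{−(d+1)}·φ` (coarse unit blocks → fine scalar blocks) — the input `φ_t` of n15-c∕238∕240–243. [cite: King1986, p.664; Balaban1985BackgroundPropagators, (3.19) p.393, Thm 3.14 pp.426–427 (mechanism)] -/
theorem hasMaj_idef_nu_csavg_transpose (T : Fin (d + 1) → Tor (fine (L ^ k) M) → Matrix ι ι ℝ) (T' : Fin (d + 1) → Tor (fine (L ^ m * L ^ k) M) → Matrix ι ι ℝ) {φ : ℝ} (hφ : 0 ≤ φ)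
    (hfit : ∀ (x' : Tor (fine (L ^ m * L ^ k) M)) (i : ι), ∑ j, |((cvaStair M (L ^ m * L ^ k) (fun μ b => T' μ b.1) (blockOf (L ^ m * L ^ k) M x') (blockCoords (L ^ m * L ^ k) M x').2 0) - (cvaStair M (L ^ k) (fun μ b => T μ b.1) (blockOf (L ^ k) M (kingPr L k m M x')) (blockCoords (L ^ k) M (kingPr L k m M x')).2 0)) j i| ≤ φ) :
    HasMaj (BlockNorm.ofBlocks (unitTorusGeo L k M) (liftBlk (fun y : Tor M => y) ι)) (BlockNorm.ofBlocks (unitTorusGeo L k M) (liftBlk (blockOf (L ^ m * L ^ k) M) ι)) (idef (((((L ^ m) ^ (d + 1) : ℕ) : ℝ)) • (LinearMap.id : (Tor M × ι → ℝ) →ₗ[ℝ] (Tor M × ι → ℝ))) (pull (liftMap (kingPr L k m M) ι)) (Matrix.mulVecLin (csavg M (L ^ m * L ^ k) T')ᵀ) (Matrix.mulVecLin (csavg M (L ^ k) T)ᵀ)) (fun y y' => if y = y' then (((((L ^ k : ℕ) : ℝ)) ^ (d + 1)))⁻¹ * φ else 0) := by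
  have hRD : (0 : ℝ) ≤ (((((L ^ k : ℕ) : ℝ)) ^ (d + 1)))⁻¹ := by positivity
  have h := hasMaj_of_mmul_pull (g := unitTorusGeo L k M) (fun y : Tor M => y) (blockOf (L ^ m * L ^ k) M)
    (c := fun x' => (((((L ^ k : ℕ) : ℝ)) ^ (d + 1)))⁻¹ • ((cvaStair M (L ^ m * L ^ k) (fun μ b => T' μ b.1) (blockOf (L ^ m * L ^ k) M x') (blockCoords (L ^ m * L ^ k) M x').2 0) - (cvaStair M (L ^ k) (fun μ b => T μ b.1) (blockOf (L ^ k) M (kingPr L k m M x')) (blockCoords (L ^ k) M (kingPr L k m M x')).2 0))ᵀ) (o := fun _ => (((((L ^ k : ℕ) : ℝ)) ^ (d + 1)))⁻¹ * φ)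
    (T := idef (((((L ^ m) ^ (d + 1) : ℕ) : ℝ)) • (LinearMap.id : (Tor M × ι → ℝ) →ₗ[ℝ] (Tor M × ι → ℝ))) (pull (liftMap (kingPr L k m M) ι)) (Matrix.mulVecLin (csavg M (L ^ m * L ^ k) T')ᵀ) (Matrix.mulVecLin (csavg M (L ^ k) T)ᵀ))
    (fun f p => by
      obtain ⟨x', i⟩ := p
      rw [idef_nu_csavg_transpose_apply, Finset.mul_sum]
      exact Finset.sum_congr rfl fun j _ => by simp only [Matrix.smul_apply, Matrix.transpose_apply, smul_eq_mul, mul_assoc])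
    (fun _ => by positivity)
    (fun x' i => by
      calc ∑ j, |((((((L ^ k : ℕ) : ℝ)) ^ (d + 1)))⁻¹ • ((cvaStair M (L ^ m * L ^ k) (fun μ b => T' μ b.1) (blockOf (L ^ m * L ^ k) M x') (blockCoords (L ^ m * L ^ k) M x').2 0) - (cvaStair M (L ^ k) (fun μ b => T μ b.1) (blockOf (L ^ k) M (kingPr L k m M x')) (blockCoords (L ^ k) M (kingPr L k m M x')).2 0))ᵀ) i j| = (((((L ^ k : ℕ) : ℝ)) ^ (d + 1)))⁻¹ * ∑ j, |((cvaStair M (L ^ m * L ^ k) (fun μ b => T' μ b.1) (blockOf (L ^ m * L ^ k) M x') (blockCoords (L ^ m * L ^ k) M x').2 0) - (cvaStair M (L ^ k) (fun μ b => T μ b.1) (blockOf (L ^ k) M (kingPr L k m M x')) (blockCoords (L ^ k) M (kingPr L k m M x')).2 0)) j i| := by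
            rw [Finset.mul_sum]
            exact Finset.sum_congr rfl fun j _ => by rw [Matrix.smul_apply, Matrix.transpose_apply, smul_eq_mul, abs_mul, abs_of_nonneg hRD]
        _ ≤ (((((L ^ k : ℕ) : ℝ)) ^ (d + 1)))⁻¹ * φ := mul_le_mul_of_nonneg_left (hfit x' i) hRD)
  exact h.mono fun y y' => le_of_eq (by simp only [diagK])

end Stair

end Summit.QuantumFields.YangMills.BalabanUVNodes.N15.CovLandau

end
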